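import Literature.MathematicalPhysics.QuantumLattice.LiebRobinson
import Literature.MathematicalPhysics.QuantumLattice.StabilityFinalArgumentProofs
import HarnessLib

/-!
# Reduction of the Michalakis–Zwolak stability theorem to its per-volume analytic core

Top-down layer of the formalisation of `Literature.MathematicalPhysics.QuantumLattice.michalakis_zwolak`
(hubbard.S19; Michalakis–Zwolak, CMP **322** (2013) 277 = arXiv:1109.1588, Theorem 1). The named
fact quantifies over families of frustration-free LTQO projector interactions `Φ L` on the
decorated tori `(ℤ/Lℤ)^d × κ` and finite-range perturbations `V L`, and asserts a threshold `ε₀`,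
a size `L₀` and a *decaying* splitting `w L` such that `H₀(L) + εV(L)` keeps `m L` low-lying
eigenvalues of spread `≤ w L` below a gap `γ/2`, uniformly in `|ε| < ε₀` and `L ≥ L₀`.

This file performs, once and for all, the bookkeeping that turns the abstract final argument
(`hasClusterGap_of_stabilityCore`, MZ13 §7) into the named fact: it proves
`michalakis_zwolak d q` from the **lattice analytic core** — the statement that, for the data of
`michalakis_zwolak`, there are `ε₁ > 0`, `L₁` and a decaying `δ : ℕ → ℝ` such that for
`|ε| < ε₁`, `L ≥ L₁` and every coupling `s ∈ [0, 1]` at which all `H₀ + tεV`, `t ≤ s`, have an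
`m L`-cluster of width `≤ γ` with gap `γ/2`, the rotated decomposition
`U⋆ (H₀ + sεV) U = H₀ + W + Δ + e·1` of MZ13 Proposition 1 exists with the relative form bound
`⟨x, W x⟩ ≥ −⅓⟨x, H₀ x⟩` of Proposition 2 (`cJ ≤ 1/3`, MZ13 §7 p. 15: "`J₀ = 1/(3c)`"), `W = 0` on
`ker H₀`, `Δ (ker H₀) ⊆ ker H₀` and `‖Δ‖ ≤ δ L` (Lemma 3: "`‖Δ‖` rapidly decaying in `L`").
What is discharged here (`michalakis_zwolak_of_latticeCore`):

* the degenerate volumes (empty configuration space, `m L = 0`);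
* `m L ≥ 1`, `m L = dim ker H₀(L)` and the gap form bound `γ‖x‖² ≤ ⟨x, H₀ x⟩` on `(ker H₀)ᗮ`, from
  the hypotheses `hgap`/`hloc`/`hproj` of the fact (frustration-free projector Hamiltonians:
  `IsProjectorInteraction.ker_toLin'_localHamiltonian`, `…mul_norm_sq_le_re_inner_of_mem_orthogonal`
  of `LTQOFrustrationFreeProofs`, and the whole torus as the ball `cellBall x L`);
* the choice `ε₀ = ε₁`, `w L = 2|δ L|` (decaying), `L₀ = max L₁ L₂` with `48|δ L| ≤ γ` for
  `L ≥ L₂`, and the call to `hasClusterGap_of_stabilityCore` with `β = 1/3`, `ω₀ = γ`.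

No definitions and no named facts are introduced (theorems only; the analytic core is the
hypothesis of the reduction theorem, to be discharged by the spectral-flow layers).
-/

noncomputable section

open Matrix Complex Finset Filter Module
open scoped Matrix.Norms.L2Operator InnerProductSpace ComplexOrder Topology

namespace Literature.MathematicalPhysics.QuantumLattice

open Literature.Probability.LatticeModels

/-! ### Small lemmas -/

section Lemmas

variable {n : Type*} [Fintype n] [DecidableEq n]

/-- A cluster gap on a nonempty index type has a nonempty cluster: `0 < m` (the least eigenvalue
belongs to the window). [folklore] -/
theorem _root_.Matrix.HasClusterGap.pos [Nonempty n] {A : Matrix n n ℂ} {m : ℕ} {w Δ : ℝ}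
    (h : A.HasClusterGap m w Δ) : 0 < m := by
  obtain ⟨hA, hw, -, hcount, -⟩ := h
  obtain ⟨i₀, hi₀⟩ := exists_eq_ciInf_of_finite (f := hA.eigenvalues)
  rw [← hcount, Finset.card_pos]
  exact ⟨i₀, by simp [hi₀, hw]⟩

/-- On an empty index type a cluster gap holds with `m = 0` for any admissible window and gap.
[folklore] -/
theorem _root_.Matrix.hasClusterGap_of_isEmpty [IsEmpty n] {A : Matrix n n ℂ} (hA : A.IsHermitian)
    {w Δ : ℝ} (hw : 0 ≤ w) (hΔ : 0 < Δ) : A.HasClusterGap 0 w Δ :=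
  ⟨hA, hw, hΔ, by simp [Finset.univ_eq_empty], fun i => isEmptyElim i⟩

/-- On an empty index type the cluster size of a cluster gap is `0`. [folklore] -/
theorem _root_.Matrix.HasClusterGap.eq_zero_of_isEmpty [IsEmpty n] {A : Matrix n n ℂ} {m : ℕ}
    {w Δ : ℝ} (h : A.HasClusterGap m w Δ) : m = 0 := by
  obtain ⟨hA, -, -, hcount, -⟩ := h
  rw [← hcount]
  simp [Finset.univ_eq_empty]

omit [Fintype n] [DecidableEq n] in
/-- A real multiple of a Hermitian matrix is Hermitian. [folklore] -/
theorem isHermitian_ofReal_smul {V : Matrix n n ℂ} (hV : V.IsHermitian) (ε : ℝ) :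
    ((ε : ℂ) • V).IsHermitian := by
  rw [IsHermitian, conjTranspose_smul, hV.eq]
  simp

/-- The kernel of `toEuclideanLin A` is the kernel of `toLin' A` transported to
`EuclideanSpace` (case `μ = 0` of `Matrix.eigenspace_toEuclideanLin_eq_map`). [folklore] -/
theorem ker_toEuclideanLin_eq_map (A : Matrix n n ℂ) :
    LinearMap.ker (toEuclideanLin A) =
      (LinearMap.ker (toLin' A)).map
        ((WithLp.linearEquiv 2 ℂ (n → ℂ)).symm : (n → ℂ) →ₗ[ℂ] EuclideanSpace ℂ n) := by
  have h := Matrix.eigenspace_toEuclideanLin_eq_map A 0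
  rwa [Module.End.eigenspace_zero, Module.End.eigenspace_zero] at h

/-- A decaying rate is eventually below any positive threshold in absolute value. [folklore] -/
theorem IsDecaying.exists_forall_abs_le {δ : ℕ → ℝ} (h : IsDecaying δ) {c : ℝ} (hc : 0 < c) :
    ∃ L₂ : ℕ, ∀ L, L₂ ≤ L → |δ L| ≤ c := by
  obtain ⟨L₂, hL₂⟩ := Metric.tendsto_atTop.mp h c hc
  refine ⟨L₂, fun L hL => ?_⟩
  have := hL₂ L hL
  rw [Real.dist_eq, sub_zero] at this
  exact this.le

/-- `2|δ|` decays with `δ`. [folklore] -/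
theorem IsDecaying.two_mul_abs {δ : ℕ → ℝ} (h : IsDecaying δ) : IsDecaying fun L => 2 * |δ L| := by
  have h1 : Tendsto (fun L => 2 * |δ L|) atTop (𝓝 (2 * |(0 : ℝ)|)) :=
    ((continuous_abs.tendsto _).comp h).const_mul 2
  simpa [IsDecaying] using h1

end Lemmas

/-! ### The whole torus as a ball; the ground space of `H₀(L)` -/

section Torus

variable {d L : ℕ} {κ : Type*} [Fintype κ] {q : ℕ}

/-- The torus norm is at most the side: `‖z‖ ≤ L` on `(ℤ/Lℤ)^d`. [folklore] -/
theorem torusNorm_le (z : TorusSite d L) : torusNorm (Ls := fun _ : Fin d => L) z ≤ L :=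
  Finset.sup_le fun _ _ => (min_le_right _ _).trans (Nat.sub_le _ _)

/-- The torus distance is at most the side. [folklore] -/
theorem torusDist_le (x y : TorusSite d L) : torusDist (Ls := fun _ : Fin d => L) x y ≤ L :=
  torusNorm_le _

/-- The cell ball of radius `L` is the whole decorated torus. [folklore] -/
theorem cellBall_side [NeZero L] (x : TorusSite d L) :
    (cellBall x L : Finset (TorusSite d L × κ)) = univ := by
  ext y
  simp only [mem_cellBall_iff, mem_univ, iff_true]
  exact torusDist_le x y.1

variable [DecidableEq κ] [NeZero L]

/-- Under the hypotheses of `michalakis_zwolak` at one volume: the cluster size `m` of `H₀` is the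
dimension of the common kernel `localGroundSpace Φ univ` (the Local-Gap condition at the ball
`cellBall x L = univ` pins the ground cluster of `H₀` to its kernel, and the count in a cluster
gap of width `0` is unique, `HasClusterGap.groundStateDegeneracy_eq`). MZ13 §2/§4.
[cite: MichalakisZwolakCMP2013, §4 Definitions 3, 5 (arXiv:1109.1588 pp. 7–8)] -/
theorem eq_finrank_localGroundSpace_of_hasLocalGap {Φ : Interaction (TorusSite d L × κ) q}
    {m : ℕ} {γ : ℝ} {γloc : ℕ → ℝ}
    (hgap : (localHamiltonian Φ univ).HasClusterGap m 0 γ) (hloc : HasLocalGap Φ γloc) :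
    m = finrank ℂ (localGroundSpace Φ (univ : Finset (TorusSite d L × κ))) := by
  have x₀ : TorusSite d L := fun _ => 0
  have h1 := hloc x₀ L
  rw [cellBall_side x₀] at h1
  rw [← hgap.groundStateDegeneracy_eq, ← h1.groundStateDegeneracy_eq]

/-- Under the hypotheses of `michalakis_zwolak` at one volume: `dim ker H₀ = m` on
`EuclideanSpace`. [cite: MichalakisZwolakCMP2013, §4 Definition 3 (arXiv:1109.1588 p. 7)] -/
theorem finrank_ker_toEuclideanLin_localHamiltonian {Φ : Interaction (TorusSite d L × κ) q}
    (hproj : IsProjectorInteraction Φ) {m : ℕ} {γ : ℝ} {γloc : ℕ → ℝ}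
    (hgap : (localHamiltonian Φ univ).HasClusterGap m 0 γ) (hloc : HasLocalGap Φ γloc) :
    finrank ℂ (LinearMap.ker (toEuclideanLin (localHamiltonian Φ univ))) = m := by
  rw [ker_toEuclideanLin_eq_map, LinearEquiv.finrank_map_eq, hproj.ker_toLin'_localHamiltonian,
    ← eq_finrank_localGroundSpace_of_hasLocalGap hgap hloc]

/-- Under the hypotheses of `michalakis_zwolak` at one volume: the gap form bound
`γ‖x‖² ≤ re ⟪x, H₀ x⟫` on `(ker H₀)ᗮ` (MZ13 Corollary 1 (1) for `B = Λ`: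
"`P_Λ(ε) = P₀`, for `0 ≤ ε ≤ γ`" and "`H_B ≥ ε(1 − P_B(ε))`").
[cite: MichalakisZwolakCMP2013, §4 Corollary 1 (arXiv:1109.1588 p. 7)] -/
theorem gap_form_bound_localHamiltonian {Φ : Interaction (TorusSite d L × κ) q}
    (hproj : IsProjectorInteraction Φ) {m : ℕ} {γ : ℝ} {γloc : ℕ → ℝ}
    (hgap : (localHamiltonian Φ univ).HasClusterGap m 0 γ) (hloc : HasLocalGap Φ γloc)
    {x : EuclideanSpace ℂ (TensorIndex (TorusSite d L × κ) q)}
    (hx : x ∈ (LinearMap.ker (toEuclideanLin (localHamiltonian Φ univ)))ᗮ) :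
    γ * ‖x‖ ^ 2 ≤ RCLike.re ⟪x, toEuclideanLin (localHamiltonian Φ univ) x⟫_ℂ := by
  have hm := eq_finrank_localGroundSpace_of_hasLocalGap hgap hloc
  have hgap' : (localHamiltonian Φ univ).HasClusterGap
      (finrank ℂ (localGroundSpace Φ (univ : Finset (TorusSite d L × κ)))) 0 γ := hm ▸ hgap
  refine hproj.mul_norm_sq_le_re_inner_of_mem_orthogonal hgap' ?_
  rwa [ker_toEuclideanLin_eq_map, hproj.ker_toLin'_localHamiltonian] at hx

end Torus

/-! ### The reduction -/

section Reduction

variable (d q : ℕ) {κ : Type*} [Fintype κ] [DecidableEq κ]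

/-- **`michalakis_zwolak` from its lattice analytic core.** The hypothesis `hcore` is the
per-volume analytic content of Michalakis–Zwolak's proof (Proposition 1 with Lemma 3, and
Proposition 2 with the choice `J ≤ J₀ = 1/(3c)`), stated for the data of the named fact: for
`|ε| < ε₁`, `L ≥ L₁` and every `s ∈ [0, 1]` at which all `H₀ + t εV`, `t ∈ [0, s]`, have an
`m L`-cluster of width `≤ γ` below a gap `γ/2` (this is the standing assumption
"`H_s` has spectral gap `γ_s ≥ γ' = γ/2` for `s ∈ [0, s₀]`" of MZ13 Definition 2, under which the
spectral flow `U(s)` exists), there are a unitary `U` and `W`, `Δ`, `e` with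
`U⋆ (H₀ + sεV) U = H₀ + W + Δ + e·1`, `⟨x, W x⟩ ≥ −⅓⟨x, H₀ x⟩`, `W = 0` on `ker H₀`,
`Δ (ker H₀) ⊆ ker H₀` and `‖Δ‖ ≤ δ L` with `δ` decaying (MZ13 pp. 12, 15). From it the theorem
follows by the abstract final argument `hasClusterGap_of_stabilityCore` (MZ13 §7), with
`ε₀ = ε₁`, `w L = 2|δ L|` and `L₀` so large that `48|δ L| ≤ γ`.
[cite: MichalakisZwolakCMP2013, Thm. 1, Prop. 1, Prop. 2, §7 (arXiv:1109.1588 pp. 6, 12–16)] -/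
theorem michalakis_zwolak_of_latticeCore
    (hcore : ∀ (Φ : (L : ℕ) → Interaction (TorusSite d L × κ) q) (m : ℕ → ℕ) (γ : ℝ) (r₀ : ℕ)
      (Δ γloc : ℕ → ℝ),
      (∀ (L : ℕ) [NeZero L], IsProjectorInteraction (Φ L) ∧ (Φ L).IsLocal) →
      (∀ (L : ℕ) [NeZero L], IsFrustrationFree (Φ L) univ) →
      (∀ (L : ℕ) [NeZero L] (X : Finset (TorusSite d L × κ)), r₀ < torusDiam X → Φ L X = 0) →
      (0 < γ ∧ ∀ (L : ℕ) [NeZero L], (localHamiltonian (Φ L) univ).HasClusterGap (m L) 0 γ) →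
      HasUniformLTQO Φ Δ → HasFastDecay Δ → HasUniformLocalGap Φ γloc →
      (∃ c : ℝ, ∃ p : ℕ, 0 < c ∧ ∀ ℓ : ℕ, c / ((ℓ : ℝ) + 1) ^ p ≤ γloc ℓ) →
      ∀ (r : ℕ) (V : (L : ℕ) → Interaction (TorusSite d L × κ) q),
        (∀ (L : ℕ) [NeZero L], (V L).IsLocal ∧
          (∀ X, r < torusDiam X → V L X = 0) ∧ ∀ X, ‖V L X‖ ≤ 1) →
        ∃ ε₁ > 0, ∃ L₁ : ℕ, ∃ δ : ℕ → ℝ, IsDecaying δ ∧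
          ∀ ε : ℝ, |ε| < ε₁ → ∀ (L : ℕ) [NeZero L], L₁ ≤ L → ∀ s ∈ Set.Icc (0 : ℝ) 1,
            (∀ t ∈ Set.Icc (0 : ℝ) s, ∃ ω : ℝ, ω ≤ γ ∧
              (localHamiltonian (Φ L) univ +
                (t : ℂ) • ((ε : ℂ) • localHamiltonian (V L) univ)).HasClusterGap (m L) ω (γ / 2)) →
            ∃ (U W D : Op (TorusSite d L × κ) q) (e : ℝ),
              U ∈ unitary (Op (TorusSite d L × κ) q) ∧
              star U * (localHamiltonian (Φ L) univ +
                (s : ℂ) • ((ε : ℂ) • localHamiltonian (V L) univ)) * U =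
                localHamiltonian (Φ L) univ + W + D + (e : ℂ) • 1 ∧
              (∀ x : EuclideanSpace ℂ (TensorIndex (TorusSite d L × κ) q),
                -(1 / 3 * RCLike.re ⟪x, toEuclideanLin (localHamiltonian (Φ L) univ) x⟫_ℂ) ≤
                  RCLike.re ⟪x, toEuclideanLin W x⟫_ℂ) ∧
              (∀ x : EuclideanSpace ℂ (TensorIndex (TorusSite d L × κ) q),
                toEuclideanLin (localHamiltonian (Φ L) univ) x = 0 → toEuclideanLin W x = 0) ∧
              (∀ x : EuclideanSpace ℂ (TensorIndex (TorusSite d L × κ) q),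
                toEuclideanLin (localHamiltonian (Φ L) univ) x = 0 →
                  toEuclideanLin (localHamiltonian (Φ L) univ) (toEuclideanLin D x) = 0) ∧
              ‖D‖ ≤ δ L) :
    michalakis_zwolak (κ := κ) d q := by
  intro Φ m γ r₀ Δ γloc hproj hff hrange hgap hltqo hΔ hloc hγloc r V hV
  obtain ⟨ε₁, hε₁, L₁, δ, hδ, hpack⟩ :=
    hcore Φ m γ r₀ Δ γloc hproj hff hrange hgap hltqo hΔ hloc hγloc r V hV
  have hγ : 0 < γ := hgap.1
  obtain ⟨L₂, hL₂⟩ := hδ.exists_forall_abs_le (c := γ / 48) (by positivity)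
  refine ⟨ε₁, hε₁, max L₁ L₂, fun L => 2 * |δ L|, hδ.two_mul_abs, ?_⟩
  intro ε hε L hL0 hL
  have hL₁ : L₁ ≤ L := (le_max_left _ _).trans hL
  have hδL : |δ L| ≤ γ / 48 := hL₂ L ((le_max_right _ _).trans hL)
  set H₀ := localHamiltonian (Φ L) univ with hH₀def
  set V₁ := localHamiltonian (V L) univ with hV₁def
  have hprojL : IsProjectorInteraction (Φ L) := (hproj L).1
  have hH₀psd : H₀.PosSemidef := hprojL.posSemidef_localHamiltonian univ
  have hV₁ : V₁.IsHermitian := localHamiltonian_isHermitian (hV L).1 univ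
  have hVε : ((ε : ℂ) • V₁).IsHermitian := isHermitian_ofReal_smul hV₁ ε
  have hgapL : H₀.HasClusterGap (m L) 0 γ := hgap.2 L
  rcases isEmpty_or_nonempty (TensorIndex (TorusSite d L × κ) q) with hemp | hne
  · -- empty configuration space: `m L = 0` and every cluster gap is trivial
    rw [hgapL.eq_zero_of_isEmpty]
    exact Matrix.hasClusterGap_of_isEmpty (hH₀psd.1.add hVε) (by positivity) (half_pos hγ)
  · have hm : 0 < m L := hgapL.pos
    have hK := finrank_ker_toEuclideanLin_localHamiltonian hprojL hgapL (hloc L)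
    have hform : ∀ x ∈ (LinearMap.ker (toEuclideanLin H₀))ᗮ,
        γ * ‖x‖ ^ 2 ≤ RCLike.re ⟪x, toEuclideanLin H₀ x⟫_ℂ :=
      fun x hx => gap_form_bound_localHamiltonian hprojL hgapL (hloc L) hx
    refine hasClusterGap_of_stabilityCore hH₀psd hVε hm hK hγ hform (β := 1 / 3) (δ := |δ L|)
      (ω₀ := γ) le_rfl (abs_nonneg _) (by linarith) (by linarith) ?_
    intro s hs hprev
    obtain ⟨U, W, D, e, hU, hdec, hW₁, hW₂, hD₁, hD₂⟩ := hpack ε hε L hL₁ s hs hprev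
    exact ⟨U, W, D, e, hU, hdec, hW₁, hW₂, hD₁, hD₂.trans (le_abs_self _)⟩

end Reduction

end Literature.MathematicalPhysics.QuantumLattice
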